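import Literature.Computability.Complexity.StackStreams
import Literature.Computability.Complexity.BoolEncodings
import HarnessLib

/-!
# LSD radix sort of a coded list of words on stack registers

Trunk `CplxCore`, toolkit continuing `StackStreams.lean` (streaming reader `readItemTo`,
`streamLoop`, `countLoop`) and `StackLists.lean` (`encList`, `emit`, `outRev`). The tree's only
verified sort so far is the insertion sort `Com.isort` of `StackLists.lean` (quadratic in the
number of elements); the truth-table passes of Williams' evaluation lemma (Williams 2014,
Lemma 4.2 / App. C: tables of `2ⁿ` entries re-ordered by a key) need a sort whose cost is a
small multiple of the table size. On LIFO stacks the simplest such sort is **least-significant-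
digit radix sort** with radix `2` (Knuth, TAOCP III, §5.2.5): one *stable partition pass* per key
bit, each pass a single stream over the list.

* Specification: `bitAt i v` (bit `i` of a word, least significant first, `0` beyond the end),
  `radixPass i l = l.filter (bit i = 0) ++ l.filter (bit i = 1)`, `radixIter l k` (passes on
  bits `0, …, k-1`), `lowBits k v = bitsToNat (v.take k)`; **`sorted_radixIter`**: after `k`
  passes the list is sorted (`List.Pairwise`) by `lowBits k`, hence by value for words of
  length `≤ k` (`sorted_radixIter_of_length_le`); `radixIter_perm`.
* Program, over the ten-register bank `RReg` (file `RRF`, `RRF.regs` with `simp` lemmas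
  register by register): `Radix.walk` (move `i` bits of the word aside, `i` in unary on `U`),
  `Radix.dispatch` (read bit `i`, restore the word, emit it onto the `0`- or `1`-output),
  `Radix.passBody`/`Radix.passProg` (**`runs_passProg`**: `L := encList (radixPass i l)` within
  `passCost i l = Σ_{v ∈ l} (21 |v| + 12 i + 30) + 6` steps) and `Radix.sortProg`
  (**`runs_sortProg`**: with `W = 1ᵏ`, `L := encList (radixIter l k)` within
  `k (passCost k l + 3) + 1` steps, i.e. `O(k (Σ |v| + k |l|))`, all work registers clean
  again). Callers embed the bank into theirs with `Com.map` / `Runs.map`.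

## References

* D. E. Knuth, *The Art of Computer Programming*, Vol. 3: Sorting and Searching, 2nd ed.,
  Addison–Wesley 1998, §5.2.5 (radix sorting; LSD-first with a stable distribution pass per
  digit). (Folklore material, fully proved here.)
* R. Williams, *Nonuniform ACC circuit lower bounds*, J. ACM 61(1) (2014), App. C (sorting
  passes in the multitape implementation of the evaluation lemma) [Williams2014].
* T. Nipkow, G. Klein, *Concrete Semantics with Isabelle/HOL*, Springer 2014, §7.2 — the
  verification style of `StackPrograms.lean`.
-/

namespace Literature.Computability.Complexity

open SProg

/-! ### The specification: stable partition by one bit, iterated from the least significant bit -/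

/-- Bit `i` of a word (least significant first), `false` beyond its end. [folklore] -/
def bitAt (i : ℕ) (v : List Bool) : Bool := v.getD i false

/-- One pass of LSD radix sort: the stable partition of `l` by bit `i` — the words with bit `0`,
in order, followed by the words with bit `1`, in order (Knuth, TAOCP III, §5.2.5, Algorithm R
with `M = 2`). [folklore] -/
def radixPass (i : ℕ) (l : List (List Bool)) : List (List Bool) :=
  l.filter (fun v => !bitAt i v) ++ l.filter (fun v => bitAt i v)

/-- `k` passes of LSD radix sort, on bits `0, 1, …, k - 1`. [folklore] -/
def radixIter (l : List (List Bool)) : ℕ → List (List Bool)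
  | 0 => l
  | k + 1 => radixPass k (radixIter l k)

/-- The value of the `k` low bits of a word. [folklore] -/
def lowBits (k : ℕ) (v : List Bool) : ℕ := bitsToNat (v.take k)

/-- A pass permutes. [folklore] -/
theorem radixPass_perm (i : ℕ) (l : List (List Bool)) : (radixPass i l).Perm l := by
  unfold radixPass
  have h := List.filter_append_perm (fun v => !bitAt i v) l
  simpa using h

/-- Radix sort permutes. [folklore] -/
theorem radixIter_perm (l : List (List Bool)) : ∀ k, (radixIter l k).Perm l
  | 0 => List.Perm.refl _
  | k + 1 => (radixPass_perm k _).trans (radixIter_perm l k)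

/-- Lengths are preserved. [folklore] -/
theorem length_radixIter (l : List (List Bool)) (k : ℕ) : (radixIter l k).length = l.length :=
  (radixIter_perm l k).length_eq

/-- `k` passes starting at bit `i` (the loop of the sorter peels the lowest bit first).
[folklore] -/
def radixFrom : ℕ → ℕ → List (List Bool) → List (List Bool)
  | _, 0, l => l
  | i, k + 1, l => radixFrom (i + 1) k (radixPass i l)

/-- Peeling the last pass instead of the first. [folklore] -/
theorem radixFrom_succ (k : ℕ) : ∀ (i : ℕ) (l : List (List Bool)),
    radixFrom i (k + 1) l = radixPass (i + k) (radixFrom i k l) := by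
  induction k with
  | zero => intro i l; rfl
  | succ k ih =>
    intro i l
    calc radixFrom i (k + 2) l = radixFrom (i + 1) (k + 1) (radixPass i l) := rfl
      _ = radixPass (i + 1 + k) (radixFrom (i + 1) k (radixPass i l)) := ih _ _
      _ = radixPass (i + (k + 1)) (radixFrom i (k + 1) l) := by rw [show i + 1 + k = i + (k + 1) by omega]; rfl

/-- `radixIter` is `radixFrom 0`. [folklore] -/
theorem radixIter_eq_radixFrom (l : List (List Bool)) : ∀ k, radixIter l k = radixFrom 0 k l
  | 0 => rfl
  | k + 1 => by rw [radixFrom_succ, Nat.zero_add, ← radixIter_eq_radixFrom l k]; rfl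

/-- `radixFrom` permutes. [folklore] -/
theorem radixFrom_perm : ∀ (i k : ℕ) (l : List (List Bool)), (radixFrom i k l).Perm l
  | _, 0, _ => List.Perm.refl _
  | i, k + 1, l => (radixFrom_perm (i + 1) k _).trans (radixPass_perm i l)

/-- One more low bit: `lowBits (k+1) v = lowBits k v + 2^k · bit_k`. [folklore] -/
theorem lowBits_succ (k : ℕ) (v : List Bool) :
    lowBits (k + 1) v = lowBits k v + 2 ^ k * (bitAt k v).toNat := by
  unfold lowBits bitAt
  rw [List.take_add_one, bitsToNat_append, List.getD_eq_getElem?_getD]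
  cases h : v[k]? with
  | none => simp
  | some b =>
    have hk : k < v.length := by
      by_contra hk'
      rw [List.getElem?_eq_none (by omega)] at h
      simp at h
    simp [List.length_take, min_eq_left hk.le]

/-- The low bits are below `2^k`. [folklore] -/
theorem lowBits_lt (k : ℕ) (v : List Bool) : lowBits k v < 2 ^ k := by
  unfold lowBits
  refine (bitsToNat_lt _).trans_le (Nat.pow_le_pow_right two_pos ?_)
  simp

/-- For a word of length `≤ k` the low bits are the whole value. [folklore] -/
theorem lowBits_of_length_le {k : ℕ} {v : List Bool} (h : v.length ≤ k) :
    lowBits k v = bitsToNat v := by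
  unfold lowBits; rw [List.take_of_length_le h]

/-- **LSD radix sort sorts**: after `k` passes the list is sorted by the value of the `k` low
bits (Knuth, TAOCP III, §5.2.5: "the least significant digit first … each pass being stable").
[folklore] -/
theorem sorted_radixIter (l : List (List Bool)) :
    ∀ k, (radixIter l k).Pairwise (fun a b => lowBits k a ≤ lowBits k b)
  | 0 => by
    simp only [radixIter, lowBits, List.take_zero, bitsToNat_nil, le_refl]
    exact List.pairwise_of_forall fun _ _ => trivial
  | k + 1 => by
    have ih := sorted_radixIter l k
    set l' := radixIter l k
    change List.Pairwise _ (radixPass k l')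
    unfold radixPass
    rw [List.pairwise_append]
    refine ⟨?_, ?_, ?_⟩
    · refine (ih.filter _).imp_of_mem ?_
      intro a b ha hb hab
      rw [List.mem_filter] at ha hb
      rw [lowBits_succ, lowBits_succ]
      have ha' : bitAt k a = false := by simpa using ha.2
      have hb' : bitAt k b = false := by simpa using hb.2
      simp [ha', hb', hab]
    · refine (ih.filter _).imp_of_mem ?_
      intro a b ha hb hab
      rw [List.mem_filter] at ha hb
      rw [lowBits_succ, lowBits_succ]
      simp [ha.2, hb.2, hab]
    · intro a ha b hb
      rw [List.mem_filter] at ha hb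
      have ha' : bitAt k a = false := by simpa using ha.2
      rw [lowBits_succ, lowBits_succ, ha', hb.2]
      simp
      have := lowBits_lt k a
      omega

/-- Hence words of length `≤ k` come out sorted by value. [folklore] -/
theorem sorted_radixIter_of_length_le (l : List (List Bool)) {k : ℕ}
    (h : ∀ v ∈ l, v.length ≤ k) :
    (radixIter l k).Pairwise (fun a b => bitsToNat a ≤ bitsToNat b) := by
  refine (sorted_radixIter l k).imp_of_mem ?_
  intro a b ha hb hab
  rwa [lowBits_of_length_le (h a ((radixIter_perm l k).subset ha)),
    lowBits_of_length_le (h b ((radixIter_perm l k).subset hb))] at hab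


/-! ### The register bank of the sorter -/

/-- Registers of the radix sorter: the list `L`, the current word `A`, the reversed outputs `z`
(bit `0`) and `o` (bit `1`), the token register `w`, the reader's scratch `t`, the bit-index
counter `U` (unary) with its parking register `V`, the prefix holder `p`, and the pass counter
`W`. [folklore] -/
inductive RReg
  | L | A | z | o | w | t | U | V | p | W
  deriving DecidableEq, Fintype, Repr

/-- The register file of the sorter by name. [folklore] -/
structure RRF where
  /-- the list -/ (L : List Bool)
  /-- the current word -/ (A : List Bool)
  /-- reversed output, bit `0` -/ (z : List Bool)
  /-- reversed output, bit `1` -/ (o : List Bool)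
  /-- token register -/ (w : List Bool)
  /-- reader scratch -/ (t : List Bool)
  /-- bit-index counter -/ (U : List Bool)
  /-- parking for `U` -/ (V : List Bool)
  /-- prefix holder -/ (p : List Bool)
  /-- pass counter -/ (W : List Bool)

namespace RRF

/-- The register file as a function. [folklore] -/
def regs (ρ : RRF) : Regs RReg
  | .L => ρ.L | .A => ρ.A | .z => ρ.z | .o => ρ.o | .w => ρ.w
  | .t => ρ.t | .U => ρ.U | .V => ρ.V | .p => ρ.p | .W => ρ.W

section Simp

variable (ρ : RRF) (v : List Bool)

/-- reading `L` [folklore] -/ @[simp] theorem regs_L : regs ρ .L = ρ.L := rfl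
/-- reading `A` [folklore] -/ @[simp] theorem regs_A : regs ρ .A = ρ.A := rfl
/-- reading `z` [folklore] -/ @[simp] theorem regs_z : regs ρ .z = ρ.z := rfl
/-- reading `o` [folklore] -/ @[simp] theorem regs_o : regs ρ .o = ρ.o := rfl
/-- reading `w` [folklore] -/ @[simp] theorem regs_w : regs ρ .w = ρ.w := rfl
/-- reading `t` [folklore] -/ @[simp] theorem regs_t : regs ρ .t = ρ.t := rfl
/-- reading `U` [folklore] -/ @[simp] theorem regs_U : regs ρ .U = ρ.U := rfl
/-- reading `V` [folklore] -/ @[simp] theorem regs_V : regs ρ .V = ρ.V := rfl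
/-- reading `p` [folklore] -/ @[simp] theorem regs_p : regs ρ .p = ρ.p := rfl
/-- reading `W` [folklore] -/ @[simp] theorem regs_W : regs ρ .W = ρ.W := rfl

/-- updating `L` [folklore] -/
@[simp] theorem update_L : Function.update (regs ρ) .L v = regs { ρ with L := v } := by
  funext i; cases i <;> rfl
/-- updating `A` [folklore] -/
@[simp] theorem update_A : Function.update (regs ρ) .A v = regs { ρ with A := v } := by
  funext i; cases i <;> rfl
/-- updating `z` [folklore] -/
@[simp] theorem update_z : Function.update (regs ρ) .z v = regs { ρ with z := v } := by
  funext i; cases i <;> rfl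
/-- updating `o` [folklore] -/
@[simp] theorem update_o : Function.update (regs ρ) .o v = regs { ρ with o := v } := by
  funext i; cases i <;> rfl
/-- updating `w` [folklore] -/
@[simp] theorem update_w : Function.update (regs ρ) .w v = regs { ρ with w := v } := by
  funext i; cases i <;> rfl
/-- updating `t` [folklore] -/
@[simp] theorem update_t : Function.update (regs ρ) .t v = regs { ρ with t := v } := by
  funext i; cases i <;> rfl
/-- updating `U` [folklore] -/
@[simp] theorem update_U : Function.update (regs ρ) .U v = regs { ρ with U := v } := by
  funext i; cases i <;> rfl
/-- updating `V` [folklore] -/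
@[simp] theorem update_V : Function.update (regs ρ) .V v = regs { ρ with V := v } := by
  funext i; cases i <;> rfl
/-- updating `p` [folklore] -/
@[simp] theorem update_p : Function.update (regs ρ) .p v = regs { ρ with p := v } := by
  funext i; cases i <;> rfl
/-- updating `W` [folklore] -/
@[simp] theorem update_W : Function.update (regs ρ) .W v = regs { ρ with W := v } := by
  funext i; cases i <;> rfl

end Simp

/-- Two files agree iff they agree register by register. [folklore] -/
theorem mk_inj {ρ ρ' : RRF} (h : regs ρ = regs ρ') : ρ = ρ' := by
  obtain ⟨⟩ := ρ; obtain ⟨⟩ := ρ'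
  have := fun r => congrFun h r
  have hL := this .L; have hA := this .A; have hz := this .z; have ho := this .o
  have hw := this .w; have ht := this .t; have hU := this .U; have hV := this .V
  have hp := this .p; have hW := this .W
  simp only [regs] at hL hA hz ho hw ht hU hV hp hW
  subst hL hA hz ho hw ht hU hV hp hW; rfl

end RRF

namespace Radix

open Com RRF

/-! ### Walking to bit `i` -/

/-- One step of the walk: move the top bit of `A` onto `p` (nothing if `A` is empty) and park
the consumed counter token on `V`. [folklore] -/
def walkBody : Com RReg :=
  pop .A (push .p true ;; push .V true) (push .p false ;; push .V true) (push .V true)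

/-- `walk`: per token of `U`, one `walkBody`; afterwards `A` has lost its first `i` bits (now
reversed on `p`), `U` is empty and its `i` tokens are on `V`. [folklore] -/
def walk : Com RReg := countLoop .U walkBody

/-- Effect of `walk`. [folklore] -/
theorem runs_walk : ∀ (i : ℕ) (ρ : RRF) (v : List Bool), ρ.A = v → ρ.U = List.replicate i true →
    Runs walk (regs ρ) (regs { ρ with
      A := v.drop i, p := (v.take i).reverse ++ ρ.p, U := []
      V := List.replicate i true ++ ρ.V }) (6 * i + 1)
  | 0, ρ, v, hA, hU => by
    refine (Runs.loop_nil _ _ (by simpa using hU)).of_eq ?_ (by omega)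
    obtain ⟨⟩ := ρ; simp only at hA hU; subst hA hU; simp
  | i + 1, ρ, v, hA, hU => by
    have hk : regs ρ .U = true :: List.replicate i true := by simp [hU, List.replicate_succ]
    cases v with
    | nil =>
      set ρ₁ : RRF := { ρ with U := List.replicate i true, V := true :: ρ.V } with hρ₁
      have hb : Runs walkBody (Function.update (regs ρ) .U (List.replicate i true)) (regs ρ₁) 4 := by
        have h1 : Runs (push RReg.V true) (Function.update (regs ρ) .U (List.replicate i true))
            (regs ρ₁) 1 :=
          Runs.push' (by rw [hρ₁]; simp)
        exact (Runs.pop_nil _ _ (by simp [hA]) h1).of_eq rfl (by omega)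
      have ih := runs_walk i ρ₁ [] (by rw [hρ₁]; exact hA) (by rw [hρ₁])
      refine (Runs.loop_true hk hb ih).of_eq ?_ (by omega)
      rw [hρ₁]; simp [List.replicate_succ]
    | cons b v =>
      set ρ₁ : RRF := { ρ with A := v, p := b :: ρ.p, U := List.replicate i true, V := true :: ρ.V }
        with hρ₁
      have hb : Runs walkBody (Function.update (regs ρ) .U (List.replicate i true)) (regs ρ₁) 4 := by
        cases b with
        | true =>
          have h2 : Runs (push RReg.p true ;; push RReg.V true)
              (Function.update (Function.update (regs ρ) .U (List.replicate i true)) .A v)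
              (regs ρ₁) 2 :=
            (Runs.push RReg.p true _).seq (Runs.push' (by rw [hρ₁]; simp))
          exact (Runs.pop_true _ _ (w := v) (by simp [hA]) h2).of_eq rfl (by omega)
        | false =>
          have h2 : Runs (push RReg.p false ;; push RReg.V true)
              (Function.update (Function.update (regs ρ) .U (List.replicate i true)) .A v)
              (regs ρ₁) 2 :=
            (Runs.push RReg.p false _).seq (Runs.push' (by rw [hρ₁]; simp))
          exact (Runs.pop_false _ _ (w := v) (by simp [hA]) h2).of_eq rfl (by omega)
      have ih := runs_walk i ρ₁ v (by rw [hρ₁]) (by rw [hρ₁])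
      refine (Runs.loop_true hk hb ih).of_eq ?_ (by omega)
      rw [hρ₁]; simp [List.replicate_succ]

/-! ### Restoring the word and dispatching it by its bit -/

/-- `restore`: pour the prefix back onto `A` and the parked tokens back onto `U`. [folklore] -/
def restore : Com RReg := pour .p .A ;; pour .V .U

/-- Effect of `restore`. [folklore] -/
theorem runs_restore (ρ : RRF) :
    Runs restore (regs ρ) (regs { ρ with
      A := ρ.p.reverse ++ ρ.A, p := [], U := ρ.V.reverse ++ ρ.U, V := [] })
      (3 * ρ.p.length + 3 * ρ.V.length + 2) := by
  have h1 := runs_pour (a := RReg.p) (b := RReg.A) (by decide) (regs ρ)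
  have h2 := runs_pour (a := RReg.V) (b := RReg.U) (by decide)
    (regs { ρ with A := ρ.p.reverse ++ ρ.A, p := [] })
  simp only [regs_p, regs_A, update_p, update_A, regs_V, regs_U, update_V, update_U] at h1 h2
  exact (h1.seq h2).of_eq rfl (by omega)

/-- Bit `i` is the first bit after dropping `i` bits. [folklore] -/
theorem bitAt_eq_getD_drop (i : ℕ) (v : List Bool) : bitAt i v = (v.drop i).getD 0 false := by
  rw [bitAt, List.getD_eq_getElem?_getD, List.getD_eq_getElem?_getD, List.getElem?_drop,
    Nat.add_zero]

/-- `dispatch`: look at the top bit of `A` (bit `i` of the word after the walk; an exhausted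
word counts as bit `0`), put it back, restore the word and the counter, and emit the word onto
`o` (bit `1`) or `z` (bit `0`). [folklore] -/
def dispatch : Com RReg :=
  pop .A (push .A true ;; restore ;; emit .A .o) (push .A false ;; restore ;; emit .A .z)
    (restore ;; emit .A .z)

/-- Effect of `dispatch` after a walk to bit `i` of `v`. [folklore] -/
theorem runs_dispatch (i : ℕ) (v : List Bool) (ρ : RRF) (hA : ρ.A = v.drop i)
    (hp : ρ.p = (v.take i).reverse) (hU : ρ.U = []) (hV : ρ.V = List.replicate i true) :
    Runs dispatch (regs ρ) (regs { ρ with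
      A := [], p := [], U := List.replicate i true, V := []
      z := if bitAt i v then ρ.z else true :: false :: (dbl v).reverse ++ ρ.z
      o := if bitAt i v then true :: false :: (dbl v).reverse ++ ρ.o else ρ.o })
      (4 * v.length + 6 * i + 8) := by
  have hpl : ρ.p.length ≤ i := by rw [hp]; simp
  have hVl : ρ.V.length = i := by rw [hV]; simp
  have hbit := bitAt_eq_getD_drop i v
  rw [← hA] at hbit
  -- the state with the word restored
  set ρ₂ : RRF := { ρ with A := v, p := [], U := List.replicate i true, V := [] } with hρ₂
  have hrest : ∀ ρ₁ : RRF, ρ₁ = { ρ with A := v.drop i } →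
      Runs restore (regs ρ₁) (regs ρ₂) (6 * i + 2) := by
    rintro ρ₁ rfl
    refine (runs_restore _).of_eq ?_ ?_
    · rw [hρ₂]; simp [hp, hU, hV]
    · simp only; omega
  cases hd : ρ.A with
  | nil =>
    rw [hd] at hbit
    simp only [List.getD_nil] at hbit
    have h1 := hrest ρ (by obtain ⟨⟩ := ρ; simp only at hA hd ⊢; rw [← hA, hd])
    have h2 := runs_emit (h := RReg.A) (o := RReg.z) (by decide) (regs ρ₂)
    refine (Runs.pop_nil _ _ (by simp [hd]) (h1.seq h2)).of_eq ?_ (by simp [hρ₂]; omega)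
    rw [hρ₂, hbit]; simp [dbl]
  | cons b rest =>
    rw [hd] at hbit
    simp only [List.getD_cons_zero] at hbit
    have h1 := hrest { ρ with A := b :: rest } (by obtain ⟨⟩ := ρ; simp only at hA hd ⊢; rw [← hA, hd])
    cases b with
    | true =>
      have h0 : Runs (push RReg.A true) (Function.update (regs ρ) .A rest)
          (regs { ρ with A := true :: rest }) 1 := Runs.push' (by simp)
      have h2 := runs_emit (h := RReg.A) (o := RReg.o) (by decide) (regs ρ₂)
      refine (Runs.pop_true _ _ (by simp [hd]) (h0.seq (h1.seq h2))).of_eq ?_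
        (by simp [hρ₂]; omega)
      rw [hρ₂, hbit]; simp [dbl]
    | false =>
      have h0 : Runs (push RReg.A false) (Function.update (regs ρ) .A rest)
          (regs { ρ with A := false :: rest }) 1 := Runs.push' (by simp)
      have h2 := runs_emit (h := RReg.A) (o := RReg.z) (by decide) (regs ρ₂)
      refine (Runs.pop_false _ _ (by simp [hd]) (h0.seq (h1.seq h2))).of_eq ?_
        (by simp [hρ₂]; omega)
      rw [hρ₂, hbit]; simp [dbl]

/-! ### One pass -/

/-- The body of a pass: read the next word, walk to its bit `i`, dispatch. [folklore] -/
def passBody : Com RReg := readItemTo .L .A .w .t ;; walk ;; dispatch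

/-- Effect of the body on the next word `v`: it leaves `L` and lands, coded, on `o` or `z`
according to its bit `i`; cost `15 |v| + 12 i + 18`. [folklore] -/
theorem runs_passBody (i : ℕ) (v rest : List Bool) (ρ : RRF)
    (hL : ρ.L = dbl v ++ false :: true :: rest) (hA : ρ.A = []) (hw : ρ.w = []) (ht : ρ.t = [])
    (hU : ρ.U = List.replicate i true) (hV : ρ.V = []) (hp : ρ.p = []) :
    Runs passBody (regs ρ) (regs { ρ with
      L := rest
      z := if bitAt i v then ρ.z else true :: false :: (dbl v).reverse ++ ρ.z
      o := if bitAt i v then true :: false :: (dbl v).reverse ++ ρ.o else ρ.o })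
      (15 * v.length + 12 * i + 18) := by
  have h1 := runs_readItemTo (L := RReg.L) (A := RReg.A) (w := RReg.w) (t := RReg.t) (by decide)
    (by decide) (by decide) (by decide) (by decide) v rest (regs ρ) (by simpa using hL)
    (by simpa using hw) (by simpa using ht)
  simp only [regs_A, update_L, update_A, hA, List.append_nil] at h1
  have h2 := runs_walk i { ρ with L := rest, A := v } v rfl hU
  have h3 := runs_dispatch i v { ρ with
      L := rest, A := v.drop i, p := (v.take i).reverse ++ ρ.p, U := []
      V := List.replicate i true ++ ρ.V } rfl (by simp [hp]) rfl (by simp [hV])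
  refine (h1.seq (h2.seq h3)).of_eq ?_ (by omega)
  simp [hA, hU, hV, hp]

/-- `passProg`: one pass of radix sort on bit `i` (held in unary on `U`): dispatch every word,
then pour the `1`-words and the `0`-words back onto `L`. [folklore] -/
def passProg : Com RReg := streamLoop .L .w passBody ;; pour .o .L ;; pour .z .L

/-- The cost of a pass on bit `i` over the words `l`. [folklore] -/
def passCost (i : ℕ) (l : List (List Bool)) : ℕ :=
  (l.map fun v => 21 * v.length + 12 * i + 30).sum + 6

/-- `passCost` is invariant under permutation of the words. [folklore] -/
theorem passCost_perm {i : ℕ} {l l' : List (List Bool)} (h : l.Perm l') :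
    passCost i l = passCost i l' := by
  unfold passCost; rw [(h.map _).sum_eq]

/-- `passCost` is monotone in the bit index. [folklore] -/
theorem passCost_mono {i j : ℕ} (h : i ≤ j) (l : List (List Bool)) : passCost i l ≤ passCost j l := by
  unfold passCost
  refine Nat.add_le_add_right (List.sum_le_sum fun v _ => ?_) _
  have := Nat.mul_le_mul_left 12 h
  omega

/-- Length of a reversed output. [folklore] -/
theorem length_outRev (E : List (List Bool)) :
    (outRev E).length = (E.map fun v => 2 * v.length + 2).sum := by
  rw [← List.length_reverse, reverse_outRev, length_encList]

/-- **Effect of one pass**: `L := encList (radixPass i l)`, all work registers clean again,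
within `passCost i l` steps. [folklore] -/
theorem runs_passProg (i : ℕ) (l : List (List Bool)) (ρ : RRF) (hL : ρ.L = encList l)
    (hA : ρ.A = []) (hz : ρ.z = []) (ho : ρ.o = []) (hw : ρ.w = []) (ht : ρ.t = [])
    (hU : ρ.U = List.replicate i true) (hV : ρ.V = []) (hp : ρ.p = []) :
    Runs passProg (regs ρ) (regs { ρ with L := encList (radixPass i l) }) (passCost i l) := by
  -- the loop
  let P : List (List Bool) → Regs RReg → Prop := fun l' R => ∃ done, l = done ++ l' ∧
    R = regs { ρ with
      L := encList l'
      z := outRev (done.filter fun v => !bitAt i v)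
      o := outRev (done.filter fun v => bitAt i v) }
  have hbody : ∀ (a : List Bool) (l' : List (List Bool)) (R : Regs RReg), P (a :: l') R →
      R .L = encList (a :: l') → R .w = [] → ∃ R', Runs passBody R R' (15 * a.length + 12 * i + 18) ∧
        R' .L = encList l' ∧ R' .w = [] ∧ P l' R' := by
    rintro a l' R ⟨done, hdone, rfl⟩ - -
    refine ⟨_, runs_passBody i a (encList l') _ (by simp [encList_cons_eq_dbl]) (by simp [hA])
      (by simp [hw]) (by simp [ht]) (by simp [hU]) (by simp [hV]) (by simp [hp]), by simp, by simp [hw],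
      done ++ [a], by simp [hdone], ?_⟩
    cases hb : bitAt i a <;> simp [hb, List.filter_append, outRev_append, dbl]
  obtain ⟨R', hloop, -, -, ⟨done, hdone, rfl⟩⟩ := runs_streamLoop (L := RReg.L) (w := RReg.w)
    (by decide) encList rfl encList_cons_ne_nil P (fun a => 15 * a.length + 12 * i + 18) hbody
    l (regs ρ) ⟨[], by simp, by obtain ⟨⟩ := ρ; simp only at hL hz ho ⊢; simp [hL, hz, ho]⟩
    (by simp [hL]) (by simp [hw])
  rw [List.append_nil] at hdone
  subst hdone
  -- the two pours
  set Z := l.filter fun v => !bitAt i v with hZ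
  set O := l.filter fun v => bitAt i v with hO
  have h2 := runs_pour (a := RReg.o) (b := RReg.L) (by decide)
    (regs { ρ with L := encList ([] : List (List Bool)), z := outRev Z, o := outRev O })
  have h3 := runs_pour (a := RReg.z) (b := RReg.L) (by decide)
    (regs { ρ with L := encList O, z := outRev Z, o := [] })
  simp only [regs_o, regs_L, update_o, update_L, regs_z, update_z, encList_nil,
    reverse_outRev, List.append_nil] at h2 h3
  refine (hloop.seq (h2.seq h3)).of_eq ?_ ?_
  · rw [show encList Z ++ encList O = encList (Z ++ O) by
      rw [encList_eq_flatMap, encList_eq_flatMap, encList_eq_flatMap, List.flatMap_append]]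
    obtain ⟨⟩ := ρ; simp only at hz ho ⊢; simp [hz, ho, radixPass, hZ, hO]
  · -- cost
    have hperm : (Z ++ O).Perm l := radixPass_perm i l
    have hsum : (Z.map fun v => 2 * v.length + 2).sum + (O.map fun v => 2 * v.length + 2).sum =
        (l.map fun v => 2 * v.length + 2).sum := by
      rw [← List.sum_append, ← List.map_append, (hperm.map _).sum_eq]
    rw [length_outRev, length_outRev, passCost]
    have key : ∀ d : List (List Bool), (d.map fun a => 15 * a.length + 12 * i + 18).sum + 6 * d.length + 4 +
        (3 * (d.map fun v => 2 * v.length + 2).sum + 2) ≤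
        (d.map fun v => 21 * v.length + 12 * i + 30).sum + 6 := by
      intro d
      induction d with
      | nil => simp
      | cons a d ih => simp only [List.map_cons, List.sum_cons, List.length_cons]; omega
    have := key l
    omega

/-! ### The sorter -/

/-- `sortProg`: one pass per token of the pass counter `W`, the bit index `U` advancing by one
token after each pass — LSD radix sort on as many low bits as `W` holds tokens. [folklore] -/
def sortProg : Com RReg := countLoop .W (passProg ;; push .U true)

/-- Effect of the sorter started at bit `i` with `k` passes to go. [folklore] -/
theorem runs_sortProg_from : ∀ (k i : ℕ) (l : List (List Bool)) (ρ : RRF), ρ.L = encList l →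
    ρ.A = [] → ρ.z = [] → ρ.o = [] → ρ.w = [] → ρ.t = [] → ρ.U = List.replicate i true →
    ρ.V = [] → ρ.p = [] → ρ.W = List.replicate k true →
    Runs sortProg (regs ρ) (regs { ρ with
      L := encList (radixFrom i k l), U := List.replicate (i + k) true, W := [] })
      (k * (passCost (i + k) l + 3) + 1)
  | 0, i, l, ρ, hL, hA, hz, ho, hw, ht, hU, hV, hp, hW => by
    refine (Runs.loop_nil _ _ (by simpa using hW)).of_eq ?_ (by omega)
    obtain ⟨⟩ := ρ; simp only at hL hU hW ⊢; simp [hL, hU, hW, radixFrom]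
  | k + 1, i, l, ρ, hL, hA, hz, ho, hw, ht, hU, hV, hp, hW => by
    have hk : regs ρ .W = true :: List.replicate k true := by simp [hW, List.replicate_succ]
    set ρ₁ : RRF := { ρ with W := List.replicate k true } with hρ₁
    have h1 := runs_passProg i l ρ₁ hL hA hz ho hw ht hU hV hp
    set ρ₂ : RRF := { ρ₁ with L := encList (radixPass i l), U := List.replicate (i + 1) true } with hρ₂
    have h2 : Runs (push RReg.U true) (regs { ρ₁ with L := encList (radixPass i l) }) (regs ρ₂) 1 :=
      Runs.push' (by rw [hρ₂, hρ₁]; simp [hU, List.replicate_succ])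
    have ih := runs_sortProg_from k (i + 1) (radixPass i l) ρ₂ rfl hA hz ho hw ht rfl hV hp rfl
    refine (Runs.loop_true hk (by simpa [hρ₁] using h1.seq h2) ih).of_eq ?_ ?_
    · rw [hρ₂, hρ₁, show i + 1 + k = i + (k + 1) by omega]; rfl
    · have hc : passCost i l ≤ passCost (i + (k + 1)) l := passCost_mono (by omega) l
      have hc' : passCost (i + 1 + k) (radixPass i l) = passCost (i + (k + 1)) l := by
        rw [passCost_perm (radixPass_perm i l), show i + 1 + k = i + (k + 1) by omega]
      rw [hc'] at *
      have : k * (passCost (i + (k + 1)) l + 3) + 1 + (passCost (i + (k + 1)) l + 3) =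
          (k + 1) * (passCost (i + (k + 1)) l + 3) + 1 := by ring
      omega

/-- **LSD radix sort on stack registers.** From `L = encList l`, `W = 1ᵏ` and the work
registers empty, `sortProg` leaves `L = encList (radixIter l k)` — the words of `l` stably
sorted by the value of their `k` low bits (`sorted_radixIter`; by value for words of length
`≤ k`, `sorted_radixIter_of_length_le`) — with `U = 1ᵏ`, `W` empty and the other work
registers empty again, within `k · (passCost k l + 3) + 1` steps, where
`passCost k l = Σ_{v ∈ l} (21 |v| + 12 k + 30) + 6`: time `O(k · (Σ |v| + k |l|))`
(Knuth, TAOCP III, §5.2.5). [folklore] -/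
theorem runs_sortProg (k : ℕ) (l : List (List Bool)) (ρ : RRF) (hL : ρ.L = encList l)
    (hA : ρ.A = []) (hz : ρ.z = []) (ho : ρ.o = []) (hw : ρ.w = []) (ht : ρ.t = []) (hU : ρ.U = [])
    (hV : ρ.V = []) (hp : ρ.p = []) (hW : ρ.W = List.replicate k true) :
    Runs sortProg (regs ρ) (regs { ρ with
      L := encList (radixIter l k), U := List.replicate k true, W := [] })
      (k * (passCost k l + 3) + 1) := by
  have h := runs_sortProg_from k 0 l ρ hL hA hz ho hw ht (by simpa using hU) hV hp hW
  rwa [Nat.zero_add, ← radixIter_eq_radixFrom] at h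

end Radix

end Literature.Computability.Complexity
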